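import Mathlib.Analysis.Normed.Group.Tannery
import Mathlib.Analysis.SpecialFunctions.Pow.Asymptotics
import Mathlib.Analysis.SpecialFunctions.Log.Basic
import Mathlib.Analysis.Asymptotics.SpecificAsymptotics
import Mathlib.Analysis.SpecialFunctions.Sqrt
import Mathlib.Analysis.SpecificLimits.Normed

/-!
# Cold balls, part G: the two elementary limits

Lead c2's stub `eq_coldBalls` (equilibrium side-composition of line `exact-entropy-ledger-three-passivities`, crux
`JParityClosure.LocalSecondLaw`, stmt-AtomisticToContinuum-13081).  Pure real analysis, no project imports:
* `coldBalls_tendsto_logpow_div_sqrt` — `(A + C·(log⁺(κ(N+1)²))⁴)/√(N+1) → 0` (`log⁴ = o(id)` along `√(N+1) → ∞`);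
* `tendsto_tsum_shells` — Tannery for the dyadic shell series
  `∑ₘ (p + q·(log⁺(κ·2^{m+1}))²)·min((N+1)⁻¹, c·2^{-m}) → 0` as `N → ∞` (dominated by the summable `(p + q(…)²)·c·2^{-m}`).
-/

noncomputable section

namespace Summit.AtomisticToContinuum.HydrodynamicLimit.Theorems.LocalSecondLawEquilibrium

open Filter Topology

/-- `(a + b)⁴ ≤ 8(a⁴ + b⁴)` for `a, b ≥ 0`. -/
theorem add_pow_four_le_eight {a b : ℝ} (ha : 0 ≤ a) (hb : 0 ≤ b) : (a + b) ^ 4 ≤ 8 * (a ^ 4 + b ^ 4) := by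
  have h : 8 * (a ^ 4 + b ^ 4) - (a + b) ^ 4 = (a - b) ^ 2 * (7 * a ^ 2 + 10 * a * b + 7 * b ^ 2) := by ring
  have h2 : 0 ≤ (a - b) ^ 2 * (7 * a ^ 2 + 10 * a * b + 7 * b ^ 2) := by positivity
  linarith

/-- **`(A + C (log⁺(κ (N+1)²))⁴) / √(N+1) → 0`** (registered sub-goal `coldBalls_tendsto_logpow_div_sqrt` of stub `eq_coldBalls`). -/
theorem coldBalls_tendsto_logpow_div_sqrt :
    ∀ (A C κ : ℝ), 0 ≤ A → 0 ≤ C → 0 < κ → Tendsto (fun N : ℕ => (A + C * (max 0 (Real.log (κ * ((N + 1 : ℕ) : ℝ) ^ 2))) ^ 4) / Real.sqrt ((N + 1 : ℕ) : ℝ)) atTop (𝓝 0) := by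
  intro A C κ hA hC hκ
  set s : ℕ → ℝ := fun N => Real.sqrt ((N + 1 : ℕ) : ℝ) with hs
  have hspos : ∀ N, 0 < s N := fun N => Real.sqrt_pos.2 (by positivity)
  have hs1 : ∀ N, 1 ≤ s N := fun N => by
    rw [hs]; exact Real.one_le_sqrt.2 (by exact_mod_cast Nat.succ_le_succ (Nat.zero_le N))
  have hs2 : ∀ N, s N ^ 2 = ((N + 1 : ℕ) : ℝ) := fun N => Real.sq_sqrt (by positivity)
  have hsinf : Tendsto s atTop atTop :=
    Real.tendsto_sqrt_atTop.comp (tendsto_natCast_atTop_atTop.comp (tendsto_add_atTop_nat 1))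
  have hlog : Tendsto (fun y : ℝ => Real.log y ^ 4 / y) atTop (𝓝 0) :=
    (Real.isLittleO_pow_log_id_atTop (n := 4)).tendsto_div_nhds_zero
  set M : ℝ := A + 8 * C * |Real.log κ| ^ 4 with hM
  have hmaj : Tendsto (fun N => M * (s N)⁻¹ + 2048 * C * (Real.log (s N) ^ 4 / s N)) atTop (𝓝 0) := by
    have h1 := (tendsto_inv_atTop_zero.comp hsinf).const_mul M
    have h2 := (hlog.comp hsinf).const_mul (2048 * C)
    simpa using h1.add h2
  refine tendsto_of_tendsto_of_tendsto_of_le_of_le' tendsto_const_nhds hmaj ?_ ?_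
  · filter_upwards with N
    positivity
  · filter_upwards with N
    have hls : 0 ≤ Real.log (s N) := Real.log_nonneg (hs1 N)
    have hX0 : 0 ≤ max 0 (Real.log (κ * ((N + 1 : ℕ) : ℝ) ^ 2)) := le_max_left _ _
    have hX : max 0 (Real.log (κ * ((N + 1 : ℕ) : ℝ) ^ 2)) ≤ |Real.log κ| + 4 * Real.log (s N) := by
      have h4 : ((N + 1 : ℕ) : ℝ) ^ 2 = s N ^ 4 := by rw [← hs2]; ring
      rw [h4, Real.log_mul hκ.ne' (by positivity), Real.log_pow]
      push_cast
      refine max_le (by positivity) ?_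
      linarith [le_abs_self (Real.log κ)]
    have hX4 : (max 0 (Real.log (κ * ((N + 1 : ℕ) : ℝ) ^ 2))) ^ 4 ≤ 8 * (|Real.log κ| ^ 4 + (4 * Real.log (s N)) ^ 4) :=
      (pow_le_pow_left₀ hX0 hX 4).trans (add_pow_four_le_eight (abs_nonneg _) (by positivity))
    rw [div_eq_mul_inv]
    have hsi : 0 < (s N)⁻¹ := inv_pos.2 (hspos N)
    calc (A + C * (max 0 (Real.log (κ * ((N + 1 : ℕ) : ℝ) ^ 2))) ^ 4) * (s N)⁻¹
        ≤ (A + C * (8 * (|Real.log κ| ^ 4 + (4 * Real.log (s N)) ^ 4))) * (s N)⁻¹ := by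
          gcongr
      _ = M * (s N)⁻¹ + 2048 * C * (Real.log (s N) ^ 4 / s N) := by
          rw [hM, div_eq_mul_inv]; ring

/-- **Tannery for the dyadic shells**: with `g m = p + q (log⁺(κ 2^{m+1}))²`,
`∑ₘ g m · min((N+1)⁻¹, c 2^{-m}) → 0` as `N → ∞` (`p, q, c ≥ 0`, `κ > 0`). -/
theorem tendsto_tsum_shells {p q c κ : ℝ} (hp : 0 ≤ p) (hq : 0 ≤ q) (hc : 0 ≤ c) (hκ : 0 < κ) :
    Tendsto (fun N : ℕ => ∑' m : ℕ, (p + q * (max 0 (Real.log (κ * 2 ^ (m + 1)))) ^ 2) *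
      min (((N + 1 : ℕ) : ℝ)⁻¹) (c * (2 : ℝ)⁻¹ ^ m)) atTop (𝓝 0) := by
  set g : ℕ → ℝ := fun m => p + q * (max 0 (Real.log (κ * 2 ^ (m + 1)))) ^ 2 with hg
  have hg0 : ∀ m, 0 ≤ g m := fun m => by positivity
  -- polynomial bound of `g`: `g m ≤ α + β m²`
  set L : ℝ := |Real.log κ| + Real.log 2 with hL
  have hL0 : 0 ≤ L := by positivity
  have hgle : ∀ m : ℕ, g m ≤ (p + 2 * q * L ^ 2) + (2 * q * Real.log 2 ^ 2) * (m : ℝ) ^ 2 := by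
    intro m
    have hlog2 : 0 ≤ Real.log 2 := Real.log_nonneg one_le_two
    have h1 : max 0 (Real.log (κ * 2 ^ (m + 1))) ≤ L + Real.log 2 * m := by
      rw [Real.log_mul hκ.ne' (by positivity), Real.log_pow]
      push_cast
      refine max_le (by positivity) ?_
      rw [hL]; nlinarith [le_abs_self (Real.log κ)]
    have h0 : 0 ≤ max 0 (Real.log (κ * 2 ^ (m + 1))) := le_max_left _ _
    have h2 : (max 0 (Real.log (κ * 2 ^ (m + 1)))) ^ 2 ≤ 2 * L ^ 2 + 2 * (Real.log 2 * m) ^ 2 := by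
      have := pow_le_pow_left₀ h0 h1 2
      nlinarith [sq_nonneg (L - Real.log 2 * m)]
    simp only [hg]
    nlinarith [mul_le_mul_of_nonneg_left h2 hq]
  -- the summable majorant
  set bound : ℕ → ℝ := fun m => ((p + 2 * q * L ^ 2) + (2 * q * Real.log 2 ^ 2) * (m : ℝ) ^ 2) * (c * (2 : ℝ)⁻¹ ^ m)
    with hbound
  have hhalf : ‖((2 : ℝ)⁻¹)‖ < 1 := by rw [Real.norm_eq_abs, abs_of_pos (by norm_num)]; norm_num
  have hsum : Summable bound := by
    have h1 : Summable fun m : ℕ => (2 : ℝ)⁻¹ ^ m := summable_geometric_of_lt_one (by norm_num) (by norm_num)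
    have h2 : Summable fun m : ℕ => ((m : ℝ) ^ 2) * (2 : ℝ)⁻¹ ^ m :=
      summable_pow_mul_geometric_of_norm_lt_one 2 hhalf
    have : bound = fun m : ℕ => (p + 2 * q * L ^ 2) * c * (2 : ℝ)⁻¹ ^ m + (2 * q * Real.log 2 ^ 2) * c * (((m : ℝ) ^ 2) * (2 : ℝ)⁻¹ ^ m) := by
      funext m; simp only [hbound]; ring
    rw [this]
    exact ((h1.mul_left _).add (h2.mul_left _))
  -- termwise limit `0` and domination
  have hlim : ∀ m, Tendsto (fun N : ℕ => g m * min (((N + 1 : ℕ) : ℝ)⁻¹) (c * (2 : ℝ)⁻¹ ^ m)) atTop (𝓝 0) := by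
    intro m
    have hN : Tendsto (fun N : ℕ => ((N + 1 : ℕ) : ℝ)⁻¹) atTop (𝓝 0) :=
      tendsto_inv_atTop_zero.comp (tendsto_natCast_atTop_atTop.comp (tendsto_add_atTop_nat 1))
    have h := (hN.const_mul (g m))
    rw [mul_zero] at h
    refine tendsto_of_tendsto_of_tendsto_of_le_of_le' tendsto_const_nhds h ?_ ?_
    · filter_upwards with N; exact mul_nonneg (hg0 m) (le_min (by positivity) (by positivity))
    · filter_upwards with N; exact mul_le_mul_of_nonneg_left (min_le_left _ _) (hg0 m)
  have hdom : ∀ᶠ N : ℕ in atTop, ∀ m, ‖g m * min (((N + 1 : ℕ) : ℝ)⁻¹) (c * (2 : ℝ)⁻¹ ^ m)‖ ≤ bound m := by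
    filter_upwards with N
    intro m
    rw [Real.norm_eq_abs, abs_of_nonneg (mul_nonneg (hg0 m) (le_min (by positivity) (by positivity)))]
    exact mul_le_mul (hgle m) (min_le_right _ _) (le_min (by positivity) (by positivity)) (by positivity)
  have hT := tendsto_tsum_of_dominated_convergence hsum hlim hdom
  rwa [tsum_zero] at hT

end Summit.AtomisticToContinuum.HydrodynamicLimit.Theorems.LocalSecondLawEquilibrium

end
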